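import Literature.MathematicalPhysics.QuantumFieldTheory.Balaban1983to89.AveragingRT
import HarnessLib

/-!
# R3 (cell `ym3-torus`, YM₃ on T³ — a ladder RUNG, NOT d = 4, NOT infinite volume, NOT a mass gap, NOT the Clay problem) —
# **FREE-SLOT LAUNDERING ALONG THE AXIAL REFERENCE: a density that leaves ONE bond of every straight segment unread — the position
# chosen segment by segment — is pushed by the straight transporter `AveragingRT.axialAvg` to an EXACT multiple of product Haar,
# `(f·dU_j)∘Ū_ax⁻¹ = (∫f)•dU_{j+1}`; no finiteness hypothesis**

Width seat `ym3-torus-px8` g12 on crux `stmt-QuantumFields-19936` `UnitScaleTilt.HistoryTailL` (`--supports`, helper; THEOREMS ONLY, 0 `def`,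
0 `sorry`).  A generic strengthening of the two cross-level laundering lemmas of the N08 seat `pub-ymgap-dag-n08-d` g47 for the top-level letter
hTop (DESIGN memo `N08-HJ-LOOPPART-DESIGN-g47.md` §1 (β3)∕(β3′)): ✓`BalabanUVNodesN08AxialLaunderingWeighted.map_withDensity_axialAvg_eq_smul` (the
LAST bond of every segment free; Weil uniqueness, finite integral) and ✓`BalabanUVNodesN08AxialLaunderingFirstBond.map_withDensity_axialAvg_eq_smul_of_first`
(the FIRST bond free).  Milestone (M3) of that memo must show that a cluster's read set two levels up «contains no FULL straight segment»; with
end-bond lemmas only, that needs a free END on every segment, which can fail for `L ≥ 3` (both ends read, a middle bond free).  THIS FILE makes «no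
full segment inside the read set» literally sufficient.

THE ARGUMENT ([folklore]; Tonelli instead of Weil uniqueness, so no finiteness of `∫f` is needed).  Fix a slot `t(c) < L` on every segment and let
`R_k U := U·ext(k)` right-multiply the slot bond `line c (t c)` of every coarse bond `c` by `k(c)`.  (i) `R_k` preserves `dU_j` (lit
`AveragingRT.measurePreserving_mulRight`) and fixes `f` (hypothesis), so `∫ f·(1_A∘Ū) dU_j = ∫ f·(1_A∘Ū∘R_k) dU_j` for EVERY coarse field `k`; (ii) average
over `k ∼ dU_{j+1}` and swap the integrals (Tonelli); (iii) for fixed `U` the map `k ↦ Ū(R_k U)` is `k ↦ (A_c·k_c·B_c)_c` — the ordered product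
`AveragingRT.pathProd` along the segment with its slot factor `U(slot)` replaced by `U(slot)·k_c` (§2, induction on the position; the slots of
distinct segments are distinct bonds, §1 `line_inj`) — hence preserves `dU_{j+1}` (lit `measurePreserving_mulLeft`∕`mulRight`), so the inner integral is
`dU_{j+1}(A)`; (iv) `LHS(A) = (∫f)·dU_{j+1}(A)`.

CONTENTS.
* §1 lattice: ★ `line_inj` — `line c t = line c' t'` with `t, t' < L` forces `c = c'` and `t = t'` (standing range; subsumes lit `last_injective`∕
  `line_ne_last` and (M1)'s `first_injective`∕`line_ne_first`); `slot_injective`, `extend_slot_apply`, `extend_slot_line_of_ne`.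
* §2 algebra of the slot shear: `pathProd_shear_of_le`, `exists_pathProd_shear`, ★ `exists_axialAvg_shear` (`Ū(U·ext k) = (A_c·k_c·B_c)_c`),
  `measurable_shear`, ★ `measurePreserving_axialAvg_shear` (for fixed `U`, `k ↦ Ū(U·ext k)` preserves `dU_{j+1}`).
* §3 ★★★ `map_withDensity_axialAvg_eq_smul_of_freeSlot` (the theorem above), ★★ `map_withDensity_axialAvg_eq_smul_of_readSet` (READ-SET form: `f` reads only
  `R ⊆ PBond P j` and every segment has its slot outside `R`), ★ `map_restrict_axialAvg_eq_smul_of_freeSlot` (set form), and the two end-slot corollaries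
  `…_of_lastSlot` (= ✓p754299 without `hfin`) ∕ `…_of_firstSlot` (= (M1)'s theorem) BY SPECIALISATION `t := L − 1` ∕ `t := 0`.

HONEST SCOPE.  [folklore] measure theory on the lit objects `AveragingRT.axialAvg`∕`line`∕`fieldMeasure` (product Haar); N08-vocabulary-free; hTop, (M3),
(M4), hJ, `stub_pinnedStep`∕`stub_unitEnvelope`, `HistoryTailL` (19936), the rung `YM3TorusSU2`, any continuum limit, d = 4, a mass gap or Clay are NOT
proved here; E6′ is not decided.  YM₃ on T³ is rung R3 of the ladder, not the Clay problem.

References: T. Bałaban, Commun. Math. Phys. **109** (1987) 249–301 [Balaban1987RG1] ((0.4) p. 253: the straight transporter is the unguarded branch of the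
block averaging); T. Bałaban, Commun. Math. Phys. **98** (1985) 17–51 [Balaban1985Averaging] ((10) p. 19, product Haar `dU`); T. Bałaban, Commun. Math. Phys.
**95** (1984) 17–40 [Balaban1984PropagatorsI] ((1.7) p. 18, the straight contour).
-/

set_option autoImplicit false

noncomputable section

open MeasureTheory
open scoped ENNReal

namespace Summit.QuantumFields.YangMills.Theorems.UV3AxialLaunderingFreeSlot

open Literature.MathematicalPhysics.QuantumFieldTheory.Balaban1983to89
open Literature.MathematicalPhysics.QuantumFieldTheory.Balaban1983to89.AveragingRT

/-! ## §1 Lattice: the bonds of the straight segments are pairwise distinct -/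
section Lattice

variable {P : Params} {j : ℕ}

/-- ★ **THE BONDS OF THE STRAIGHT SEGMENTS ARE PAIRWISE DISTINCT** (standing range): `line c t = line c' t'` with `t, t' < L` forces `c = c'` and
`t = t'` — the first half of a segment lies in `B(c₋)` and the second in `B(c₊)` with offsets that record the position (lit `lineSite_eq_lo`∕`lineSite_eq_hi`,
`blockSite_inj`); a lo∕hi coincidence would need `t' = t + L`.  Subsumes lit `last_injective`∕`line_ne_last` and the first-bond twins.
[cite: Balaban1984PropagatorsI, (1.7) p.18] -/
theorem line_inj (hj : j + 1 ≤ P.m + P.K) {c c' : PBond P (j + 1)} {t t' : ℕ} (ht : t < P.L) (ht' : t' < P.L)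
    (h : line c t = line c' t') : c = c' ∧ t = t' := by
  have hL := P.hL.2
  obtain ⟨k, hk⟩ := P.hL.1
  simp only [line, PBond.mk.injEq] at h
  obtain ⟨hs, hdir⟩ := h
  have key : c.src = c'.src ∧ t = t' := by
    by_cases hlo : t ≤ (P.L - 1) / 2 <;> by_cases hlo' : t' ≤ (P.L - 1) / 2
    · rw [lineSite_eq_lo hj c hlo, lineSite_eq_lo hj c' hlo'] at hs
      obtain ⟨hsrc, hoff⟩ := blockSite_inj hj hs
      have := congrArg Fin.val (congrFun hoff c.dir)
      simp only [offLo, hdir, if_true, Fin.val_mk] at this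
      exact ⟨hsrc, by omega⟩
    · rw [lineSite_eq_lo hj c hlo, lineSite_eq_hi hj c' (lt_of_not_ge hlo') ht'.le] at hs
      obtain ⟨-, hoff⟩ := blockSite_inj hj hs
      have := congrArg Fin.val (congrFun hoff c.dir)
      simp only [offLo, offHi, hdir, if_true, Fin.val_mk] at this
      omega
    · rw [lineSite_eq_hi hj c (lt_of_not_ge hlo) ht.le, lineSite_eq_lo hj c' hlo'] at hs
      obtain ⟨-, hoff⟩ := blockSite_inj hj hs
      have := congrArg Fin.val (congrFun hoff c.dir)
      simp only [offLo, offHi, hdir, if_true, Fin.val_mk] at this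
      omega
    · rw [lineSite_eq_hi hj c (lt_of_not_ge hlo) ht.le, lineSite_eq_hi hj c' (lt_of_not_ge hlo') ht'.le] at hs
      obtain ⟨htgt, hoff⟩ := blockSite_inj hj hs
      have := congrArg Fin.val (congrFun hoff c.dir)
      simp only [offHi, hdir, if_true, Fin.val_mk] at this
      refine ⟨shift_injective c.dir ?_, by omega⟩
      simpa [PBond.tgt, hdir] using htgt
  obtain ⟨hsrc, htt⟩ := key
  refine ⟨?_, htt⟩
  cases c; cases c'; simp_all

variable (hj : j + 1 ≤ P.m + P.K) (t : PBond P (j + 1) → ℕ) (ht : ∀ c, t c < P.L)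
include hj ht

/-- The slot map `c ↦ line c (t c)` is injective. [folklore] -/
theorem slot_injective : Function.Injective (fun c : PBond P (j + 1) => line c (t c)) :=
  fun c c' h => (line_inj hj (ht c) (ht c') h).1

/-- The extended coarse field takes the value `k c` at the slot of `c`. [folklore] -/
theorem extend_slot_apply {G : Type*} [One G] (k : PBond P (j + 1) → G) (c : PBond P (j + 1)) :
    Function.extend (fun c : PBond P (j + 1) => line c (t c)) k (fun _ => 1) (line c (t c)) = k c :=
  (slot_injective hj t ht).extend_apply k (fun _ => (1 : G)) c

/-- The extended coarse field is `1` at every non-slot bond of every segment. [folklore] -/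
theorem extend_slot_line_of_ne {G : Type*} [One G] (k : PBond P (j + 1) → G) (c : PBond P (j + 1)) {s : ℕ} (hs : s < P.L)
    (hst : s ≠ t c) : Function.extend (fun c : PBond P (j + 1) => line c (t c)) k (fun _ => 1) (line c s) = 1 := by
  rw [Function.extend_apply']
  rintro ⟨c', hc'⟩
  obtain ⟨rfl, hts⟩ := line_inj hj (ht c') hs hc'
  exact hst hts.symm

end Lattice

/-! ## §2 Algebra and measurability of the slot shear `U ↦ U·ext(k)` -/
section Shear

variable {P : Params} {j : ℕ} {G : Type*} [GaugeGroup G]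
  (hj : j + 1 ≤ P.m + P.K) (t : PBond P (j + 1) → ℕ) (ht : ∀ c, t c < P.L)
include hj ht

/-- Before the slot the sheared segment product is the original one. [folklore] -/
theorem pathProd_shear_of_le (U : GaugeField P j G) (k : GaugeField P (j + 1) G) (c : PBond P (j + 1)) :
    ∀ n : ℕ, n ≤ t c →
      pathProd (fun b => U b * Function.extend (fun c : PBond P (j + 1) => line c (t c)) k (fun _ => 1) b) c n = pathProd U c n
  | 0, _ => rfl
  | n + 1, hn => by
    simp only [pathProd]
    rw [pathProd_shear_of_le U k c n (by omega),
      extend_slot_line_of_ne hj t ht k c (by have := ht c; omega) (by omega), mul_one]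

/-- Past the slot the sheared segment product is `(prefix·U(slot))·k(c)·(tail)`, the tail NOT depending on `k`. [folklore] -/
theorem exists_pathProd_shear (U : GaugeField P j G) (c : PBond P (j + 1)) :
    ∀ n : ℕ, t c < n → n ≤ P.L → ∃ b : G, ∀ k : GaugeField P (j + 1) G,
      pathProd (fun b => U b * Function.extend (fun c : PBond P (j + 1) => line c (t c)) k (fun _ => 1) b) c n =
        pathProd U c (t c) * U (line c (t c)) * k c * b
  | 0, hn, _ => absurd hn (Nat.not_lt_zero _)
  | n + 1, hn, hnL => by
    by_cases heq : n = t c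
    · subst heq
      refine ⟨1, fun k => ?_⟩
      simp only [pathProd]
      rw [pathProd_shear_of_le hj t ht U k c (t c) le_rfl, extend_slot_apply hj t ht k c, mul_one, mul_assoc]
    · obtain ⟨b, hb⟩ := exists_pathProd_shear U c n (by omega) (by omega)
      refine ⟨b * U (line c n), fun k => ?_⟩
      simp only [pathProd]
      rw [hb k, extend_slot_line_of_ne hj t ht k c (by omega) heq, mul_one, ← mul_assoc]

/-- ★ **THE SHEARED AXIAL AVERAGE IS A TWO-SIDED TRANSLATE OF `k`**: for fixed `U` there are coarse fields `A`, `B` with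
`Ū(U·ext k) = (A_c·k_c·B_c)_c` for every `k`. [cite: Balaban1984PropagatorsI, (1.7) p.18] -/
theorem exists_axialAvg_shear (U : GaugeField P j G) :
    ∃ A B : GaugeField P (j + 1) G, ∀ k : GaugeField P (j + 1) G,
      axialAvg (fun b => U b * Function.extend (fun c : PBond P (j + 1) => line c (t c)) k (fun _ => 1) b) =
        fun c => A c * k c * B c := by
  have h : ∀ c : PBond P (j + 1), ∃ b : G, ∀ k : GaugeField P (j + 1) G,
      pathProd (fun b => U b * Function.extend (fun c : PBond P (j + 1) => line c (t c)) k (fun _ => 1) b) c P.L =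
        pathProd U c (t c) * U (line c (t c)) * k c * b :=
    fun c => exists_pathProd_shear hj t ht U c P.L (ht c) le_rfl
  choose B hB using h
  refine ⟨fun c => pathProd U c (t c) * U (line c (t c)), B, fun k => ?_⟩
  funext c
  exact hB c k

variable [MeasurableSpace G] [MeasurableMul₂ G]

/-- The slot shear `(U, k) ↦ U·ext(k)` is jointly measurable. [folklore] -/
theorem measurable_shear :
    Measurable fun p : GaugeField P j G × GaugeField P (j + 1) G =>
      fun b => p.1 b * Function.extend (fun c : PBond P (j + 1) => line c (t c)) p.2 (fun _ => 1) b := by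
  refine measurable_pi_iff.mpr fun b => ?_
  have h1 : Measurable fun p : GaugeField P j G × GaugeField P (j + 1) G => p.1 b :=
    (measurable_pi_apply b).comp measurable_fst
  by_cases hb : ∃ c, line c (t c) = b
  · obtain ⟨c, rfl⟩ := hb
    have h2 : Measurable fun p : GaugeField P j G × GaugeField P (j + 1) G => p.2 c :=
      (measurable_pi_apply c).comp measurable_snd
    have heq : (fun p : GaugeField P j G × GaugeField P (j + 1) G =>
        p.1 (line c (t c)) * Function.extend (fun c : PBond P (j + 1) => line c (t c)) p.2 (fun _ => 1) (line c (t c))) =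
        fun p => p.1 (line c (t c)) * p.2 c := by
      funext p
      rw [extend_slot_apply hj t ht p.2 c]
    rw [heq]
    exact h1.mul h2
  · have heq : (fun p : GaugeField P j G × GaugeField P (j + 1) G =>
        p.1 b * Function.extend (fun c : PBond P (j + 1) => line c (t c)) p.2 (fun _ => 1) b) =
        fun p => p.1 b * 1 := by
      funext p
      rw [Function.extend_apply' _ _ _ hb]
    rw [heq]
    exact h1.mul_const 1

variable [HaarData G]

/-- ★ **FOR FIXED `U`, `k ↦ Ū(U·ext k)` PRESERVES PRODUCT HAAR ON THE COARSE FIELDS** (a two-sided coordinatewise translation, §2 + lit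
`measurePreserving_mulLeft`∕`measurePreserving_mulRight`). [cite: Balaban1985Averaging, (10) p.19] -/
theorem measurePreserving_axialAvg_shear (U : GaugeField P j G) :
    MeasurePreserving (fun k : GaugeField P (j + 1) G =>
        axialAvg (fun b => U b * Function.extend (fun c : PBond P (j + 1) => line c (t c)) k (fun _ => 1) b))
      (fieldMeasure P (j + 1) G) (fieldMeasure P (j + 1) G) := by
  obtain ⟨A, B, hAB⟩ := exists_axialAvg_shear hj t ht U
  have hcomp : (fun k : GaugeField P (j + 1) G =>
        axialAvg (fun b => U b * Function.extend (fun c : PBond P (j + 1) => line c (t c)) k (fun _ => 1) b)) =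
      (fun (v : GaugeField P (j + 1) G) (c : PBond P (j + 1)) => v c * B c) ∘
        (fun (k : GaugeField P (j + 1) G) (c : PBond P (j + 1)) => A c * k c) := by
    funext k
    rw [hAB k]
    rfl
  rw [hcomp]
  exact (measurePreserving_mulRight B).comp (measurePreserving_mulLeft A)

end Shear

/-! ## §3 Free-slot laundering -/
section Laundering

variable {P : Params} {j : ℕ} {G : Type*} [GaugeGroup G] [MeasurableSpace G] [HaarData G] [MeasurableMul₂ G]

/-- ★★★ **FREE-SLOT LAUNDERING ALONG THE AXIAL REFERENCE.**  Let `t(c) < L` pick one position on every straight segment and let `f ≥ 0` be a measurable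
density on the level-`j` fields that does NOT READ THE SLOT BONDS — precisely: `f` is invariant under right-multiplication of the bond `line c (t c)` of
every segment `c` by `k(c)`, for every coarse field `k`.  Then the straight transporter pushes `f·dU_j` to an EXACT multiple of product Haar:
`((dU_j).withDensity f).map axialAvg = (∫⁻ f dU_j) • dU_{j+1}` (standing range; no finiteness of the integral needed).  The position may vary with the
segment; `t ≡ L − 1` and `t ≡ 0` are the N08 seat's last-bond and first-bond lemmas. [cite: Balaban1987RG1, (0.4) p.253; Balaban1985Averaging, (10) p.19] -/
theorem map_withDensity_axialAvg_eq_smul_of_freeSlot (hj : j + 1 ≤ P.m + P.K) (t : PBond P (j + 1) → ℕ) (ht : ∀ c, t c < P.L)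
    {f : GaugeField P j G → ℝ≥0∞} (hf : Measurable f)
    (hfree : ∀ (k : GaugeField P (j + 1) G) (U : GaugeField P j G),
      f (fun b => U b * Function.extend (fun c : PBond P (j + 1) => line c (t c)) k (fun _ => 1) b) = f U) :
    ((fieldMeasure P j G).withDensity f).map (axialAvg : GaugeField P j G → GaugeField P (j + 1) G) =
      (∫⁻ U, f U ∂(fieldMeasure P j G)) • fieldMeasure P (j + 1) G := by
  have hmeas : Measurable (axialAvg : GaugeField P j G → GaugeField P (j + 1) G) := measurable_axialAvg
  -- the shear and the test integrand
  set S : GaugeField P j G × GaugeField P (j + 1) G → GaugeField P j G := fun p b =>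
    p.1 b * Function.extend (fun c : PBond P (j + 1) => line c (t c)) p.2 (fun _ => 1) b with hS
  have hSm : Measurable S := measurable_shear hj t ht
  ext A hA
  rw [Measure.map_apply hmeas hA, withDensity_apply _ (hmeas hA), Measure.smul_apply, smul_eq_mul]
  -- `∫_{Ū⁻¹ A} f = ∫ f · 1_A ∘ Ū`
  have hind : Measurable fun V : GaugeField P (j + 1) G => A.indicator (fun _ => (1 : ℝ≥0∞)) V :=
    measurable_const.indicator hA
  have h0 : ∫⁻ U in axialAvg ⁻¹' A, f U ∂(fieldMeasure P j G) =
      ∫⁻ U, f U * A.indicator (fun _ => (1 : ℝ≥0∞)) (axialAvg U) ∂(fieldMeasure P j G) := by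
    rw [← lintegral_indicator (hmeas hA)]
    refine lintegral_congr fun U => ?_
    by_cases hU : axialAvg U ∈ A
    · rw [Set.indicator_of_mem (show U ∈ axialAvg ⁻¹' A from hU), Set.indicator_of_mem hU, mul_one]
    · rw [Set.indicator_of_notMem (show U ∉ axialAvg ⁻¹' A from hU), Set.indicator_of_notMem hU, mul_zero]
  rw [h0]
  -- the integrand after the shear by `k`
  set F : GaugeField P j G → GaugeField P (j + 1) G → ℝ≥0∞ := fun U k =>
    f U * A.indicator (fun _ => (1 : ℝ≥0∞)) (axialAvg (S (U, k))) with hF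
  have hFm : Measurable (Function.uncurry F) := by
    have h1 : Measurable fun p : GaugeField P j G × GaugeField P (j + 1) G => f p.1 := hf.comp measurable_fst
    have h2 : Measurable fun p : GaugeField P j G × GaugeField P (j + 1) G =>
        A.indicator (fun _ => (1 : ℝ≥0∞)) (axialAvg (S p)) := hind.comp (hmeas.comp hSm)
    exact h1.mul h2
  -- (i) the value does not depend on `k`
  have hstep : ∀ k : GaugeField P (j + 1) G,
      ∫⁻ U, f U * A.indicator (fun _ => (1 : ℝ≥0∞)) (axialAvg U) ∂(fieldMeasure P j G) = ∫⁻ U, F U k ∂(fieldMeasure P j G) := by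
    intro k
    have hR := measurePreserving_mulRight (P := P) (j := j) (G := G)
      (Function.extend (fun c : PBond P (j + 1) => line c (t c)) k (fun _ => 1))
    have hg : Measurable fun U : GaugeField P j G => f U * A.indicator (fun _ => (1 : ℝ≥0∞)) (axialAvg U) :=
      hf.mul (hind.comp hmeas)
    refine (hR.lintegral_comp hg).symm.trans (lintegral_congr fun U => ?_)
    show f (fun b => U b * _) * _ = f U * _
    rw [hfree k U]
  -- (ii) average over `k` and swap
  have havg : ∫⁻ U, f U * A.indicator (fun _ => (1 : ℝ≥0∞)) (axialAvg U) ∂(fieldMeasure P j G) =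
      ∫⁻ k, ∫⁻ U, F U k ∂(fieldMeasure P j G) ∂(fieldMeasure P (j + 1) G) := by
    simp_rw [← hstep]
    rw [lintegral_const, measure_univ, mul_one]
  have hFm' : Measurable (Function.uncurry fun (k : GaugeField P (j + 1) G) (U : GaugeField P j G) => F U k) :=
    hFm.comp measurable_swap
  rw [havg, lintegral_lintegral_swap hFm'.aemeasurable]
  -- (iii) the inner integral is `dU_{j+1}(A)` for every `U`
  have hinner : ∀ U : GaugeField P j G,
      ∫⁻ k, F U k ∂(fieldMeasure P (j + 1) G) = f U * fieldMeasure P (j + 1) G A := by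
    intro U
    have hΛ := measurePreserving_axialAvg_shear hj t ht U
    have hm' : Measurable fun k : GaugeField P (j + 1) G => A.indicator (fun _ => (1 : ℝ≥0∞)) (axialAvg (S (U, k))) :=
      hind.comp hΛ.measurable
    have h2 : ∫⁻ k, A.indicator (fun _ => (1 : ℝ≥0∞)) (axialAvg (S (U, k))) ∂(fieldMeasure P (j + 1) G) =
        fieldMeasure P (j + 1) G A := by
      have := hΛ.lintegral_comp hind
      rw [lintegral_indicator_const hA, one_mul] at this
      exact this
    calc ∫⁻ k, F U k ∂(fieldMeasure P (j + 1) G)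
        = ∫⁻ k, f U * A.indicator (fun _ => (1 : ℝ≥0∞)) (axialAvg (S (U, k))) ∂(fieldMeasure P (j + 1) G) := rfl
      _ = f U * ∫⁻ k, A.indicator (fun _ => (1 : ℝ≥0∞)) (axialAvg (S (U, k))) ∂(fieldMeasure P (j + 1) G) :=
          lintegral_const_mul _ hm'
      _ = f U * fieldMeasure P (j + 1) G A := by rw [h2]
  simp_rw [hinner]
  rw [lintegral_mul_const _ hf]

/-- ★★ **READ-SET FORM**: if `f` reads only the bonds of `R ⊆ PBond P j` (`U = U′` on `R` ⇒ `f U = f U′`) and every straight segment has its slot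
`line c (t c)` OUTSIDE `R` — «no full segment inside the read set», with the free position chosen per segment — then
`((dU_j).withDensity f).map axialAvg = (∫⁻ f dU_j) • dU_{j+1}`. [cite: Balaban1987RG1, (0.4) p.253; Balaban1985Averaging, (10) p.19] -/
theorem map_withDensity_axialAvg_eq_smul_of_readSet (hj : j + 1 ≤ P.m + P.K) (t : PBond P (j + 1) → ℕ) (ht : ∀ c, t c < P.L)
    {f : GaugeField P j G → ℝ≥0∞} (hf : Measurable f) (R : Set (PBond P j))
    (hR : ∀ U U' : GaugeField P j G, (∀ b ∈ R, U b = U' b) → f U = f U') (hslot : ∀ c, line c (t c) ∉ R) :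
    ((fieldMeasure P j G).withDensity f).map (axialAvg : GaugeField P j G → GaugeField P (j + 1) G) =
      (∫⁻ U, f U ∂(fieldMeasure P j G)) • fieldMeasure P (j + 1) G := by
  refine map_withDensity_axialAvg_eq_smul_of_freeSlot hj t ht hf fun k U => hR _ _ fun b hb => ?_
  have hb' : ¬ ∃ c, line c (t c) = b := by
    rintro ⟨c, rfl⟩; exact hslot c hb
  show U b * Function.extend (fun c : PBond P (j + 1) => line c (t c)) k (fun _ => 1) b = U b
  rw [Function.extend_apply' _ _ _ hb', mul_one]

/-- ★ **SET FORM**: for a measurable event `E` of level-`j` fields invariant under the slot shear, `(dU_j↾E)∘Ū_ax⁻¹ = dU_j(E) • dU_{j+1}` — conditioning the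
axial reference on an event that leaves one bond per segment unread changes its image law only by the total mass. [folklore] -/
theorem map_restrict_axialAvg_eq_smul_of_freeSlot (hj : j + 1 ≤ P.m + P.K) (t : PBond P (j + 1) → ℕ) (ht : ∀ c, t c < P.L)
    {E : Set (GaugeField P j G)} (hE : MeasurableSet E)
    (hfree : ∀ (k : GaugeField P (j + 1) G) (U : GaugeField P j G),
      (fun b => U b * Function.extend (fun c : PBond P (j + 1) => line c (t c)) k (fun _ => 1) b) ∈ E ↔ U ∈ E) :
    ((fieldMeasure P j G).restrict E).map (axialAvg : GaugeField P j G → GaugeField P (j + 1) G) =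
      (fieldMeasure P j G E) • fieldMeasure P (j + 1) G := by
  have hinv : ∀ (k : GaugeField P (j + 1) G) (U : GaugeField P j G),
      E.indicator (1 : GaugeField P j G → ℝ≥0∞)
          (fun b => U b * Function.extend (fun c : PBond P (j + 1) => line c (t c)) k (fun _ => 1) b) =
        E.indicator (1 : GaugeField P j G → ℝ≥0∞) U := by
    intro k U
    set R : GaugeField P j G → GaugeField P j G := fun V b =>
      V b * Function.extend (fun c : PBond P (j + 1) => line c (t c)) k (fun _ => 1) b with hR
    have hpre : R ⁻¹' E = E := Set.ext fun V => hfree k V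
    show E.indicator 1 (R U) = E.indicator 1 U
    rw [← Set.indicator_comp_right, hpre]
    rfl
  rw [← withDensity_indicator_one hE, map_withDensity_axialAvg_eq_smul_of_freeSlot hj t ht (measurable_one.indicator hE) hinv,
    lintegral_indicator_one hE]

/-- **LAST-SLOT COROLLARY** (`t ≡ L − 1`): the N08 seat's ✓`BalabanUVNodesN08AxialLaunderingWeighted.map_withDensity_axialAvg_eq_smul` WITHOUT its finiteness
hypothesis. [cite: Balaban1987RG1, (0.4) p.253; Balaban1985Averaging, (10) p.19] -/
theorem map_withDensity_axialAvg_eq_smul_of_lastSlot (hj : j + 1 ≤ P.m + P.K) {f : GaugeField P j G → ℝ≥0∞} (hf : Measurable f)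
    (hlast : ∀ (k : GaugeField P (j + 1) G) (U : GaugeField P j G),
      f (fun b => U b * Function.extend (fun c : PBond P (j + 1) => line c (P.L - 1)) k (fun _ => 1) b) = f U) :
    ((fieldMeasure P j G).withDensity f).map (axialAvg : GaugeField P j G → GaugeField P (j + 1) G) =
      (∫⁻ U, f U ∂(fieldMeasure P j G)) • fieldMeasure P (j + 1) G :=
  map_withDensity_axialAvg_eq_smul_of_freeSlot hj (fun _ => P.L - 1) (fun _ => by have := P.hL.2; omega) hf hlast

/-- **FIRST-SLOT COROLLARY** (`t ≡ 0`): the N08 seat's (M1) ✓`BalabanUVNodesN08AxialLaunderingFirstBond.map_withDensity_axialAvg_eq_smul_of_first`, by specialisation.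
[cite: Balaban1987RG1, (0.4) p.253; Balaban1985Averaging, (10) p.19] -/
theorem map_withDensity_axialAvg_eq_smul_of_firstSlot (hj : j + 1 ≤ P.m + P.K) {f : GaugeField P j G → ℝ≥0∞} (hf : Measurable f)
    (hfirst : ∀ (k : GaugeField P (j + 1) G) (U : GaugeField P j G),
      f (fun b => U b * Function.extend (fun c : PBond P (j + 1) => line c 0) k (fun _ => 1) b) = f U) :
    ((fieldMeasure P j G).withDensity f).map (axialAvg : GaugeField P j G → GaugeField P (j + 1) G) =
      (∫⁻ U, f U ∂(fieldMeasure P j G)) • fieldMeasure P (j + 1) G :=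
  map_withDensity_axialAvg_eq_smul_of_freeSlot hj (fun _ => 0) (fun _ => by have := P.hL.2; omega) hf hfirst

end Laundering

end Summit.QuantumFields.YangMills.Theorems.UV3AxialLaunderingFreeSlot

end
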